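import Mathlib.MeasureTheory.Function.ConvergenceInDistribution
import Mathlib.MeasureTheory.Measure.LevyProkhorovMetric
import Mathlib.MeasureTheory.Integral.DominatedConvergence
import Mathlib.Topology.UniformSpace.CompactConvergence
import Mathlib.Topology.ContinuousMap.SecondCountableSpace
import Mathlib.Topology.Metrizable.Uniformity
import Mathlib.Topology.Order.IsLUB
import Mathlib.Analysis.SpecificLimits.Basic
import HarnessLib

/-!
# Diagonal sequences in the passage of lattice observables to a scaling limit

Topic `Literature/Probability/Process`; theorems only. Bookkeeping for the identification of
scaling limits by martingale observables (Duminil-Copin–Smirnov, Clay Math. Proc. 15 (2012),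
proof of Prop. 6.7; Chelkak–Duminil-Copin–Hongler–Kemppainen–Smirnov, C. R. Math. 352 (2014), §3)
when the lattice driving processes are only available at a fixed tolerance `ρ`: at tolerance
`ρ_m → 0` the `m`-th family of lattice drivers converges in law along the mesh sequence to an
`m`-dependent limit `Y_m` (e.g. the driving path frozen before a small time `S₀(ρ_m)`), and
`Y_m → Z` pointwise. A DIAGONAL sequence then converges in law to `Z` while meeting, at every
level `m`, any property that holds for all large meshes (`exists_diagonal_tendstoInDistribution`;
the topology of convergence in distribution on a separable pseudo-metrisable space is
pseudo-metrisable by the Lévy–Prokhorov metric, Mathlib `LevyProkhorovMetric`). The two small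
real-analysis companions: paths frozen before `S₀` converge locally uniformly to the path as
`S₀ → 0` (`ContinuousMap.tendsto_mk_comp_max_nhds_zero`), and a cylinder identity
`∫ (X_t - X_s) Ψ dμ = 0` known for all `0 < s < t` extends to `s = 0` for processes with
continuous bounded paths (`integral_sub_mul_eq_zero_zero_of_forall_pos`, dominated convergence).

No definitions, no named facts.

## References

* D. Chelkak, H. Duminil-Copin, C. Hongler, A. Kemppainen, S. Smirnov, C. R. Math. Acad. Sci.
  Paris 352 (2014) 157–161, §3.
* H. Duminil-Copin, S. Smirnov, Clay Math. Proc. 15 (2012), proof of Prop. 6.7.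
* P. Billingsley, *Convergence of Probability Measures* (2nd ed. 1999), Thm. 6.8 (Prokhorov
  metric).
-/

noncomputable section

open MeasureTheory Filter Set Topology TopologicalSpace
open scoped NNReal

namespace Literature.Probability.Process

/-! ### Diagonal sequences -/

/-- **Diagonal extraction in a pseudo-metrisable space.** If `x m n → y m` as `n → ∞` for every
`m`, `y m → z`, and each property `good m` holds for all large `n`, then some diagonal
`n = φ m` has `good m (φ m)` for all `m` and `x m (φ m) → z`. [folklore] -/
theorem exists_diagonal_tendsto {T : Type*} [TopologicalSpace T] [PseudoMetrizableSpace T]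
    {x : ℕ → ℕ → T} {y : ℕ → T} {z : T} (hx : ∀ m, Tendsto (x m) atTop (𝓝 (y m)))
    (hy : Tendsto y atTop (𝓝 z)) {good : ℕ → ℕ → Prop} (hgood : ∀ m, ∀ᶠ n in atTop, good m n) :
    ∃ φ : ℕ → ℕ, (∀ m, good m (φ m)) ∧ Tendsto (fun m ↦ x m (φ m)) atTop (𝓝 z) := by
  letI : PseudoMetricSpace T := TopologicalSpace.pseudoMetrizableSpacePseudoMetric T
  have h : ∀ m, ∃ n, good m n ∧ dist (x m n) (y m) < 1 / ((m : ℝ) + 1) := fun m ↦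
    ((hgood m).and (Metric.tendsto_nhds.1 (hx m) _ (by positivity))).exists
  choose φ hφg hφd using h
  refine ⟨φ, hφg, ?_⟩
  have h1 : Tendsto (fun m ↦ dist (x m (φ m)) (y m)) atTop (𝓝 0) :=
    squeeze_zero (fun _ ↦ dist_nonneg) (fun m ↦ (hφd m).le) tendsto_one_div_add_atTop_nhds_zero_nat
  have h2 : Tendsto (fun m ↦ dist (y m) z) atTop (𝓝 0) := tendsto_iff_dist_tendsto_zero.1 hy
  rw [tendsto_iff_dist_tendsto_zero]
  refine squeeze_zero (fun _ ↦ dist_nonneg) (fun m ↦ dist_triangle _ (y m) _) ?_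
  simpa using h1.add h2

/-- **Diagonal extraction for convergence in distribution.** Random variables
`X m n : Ω n → E` (probability spaces `(Ω n, P n)`, separable pseudo-metrisable `E`) with
`X m · → Y m` in distribution as `n → ∞` for every `m`, and `Y m → Z` in distribution on
`(Ω', μ)`; properties `good m n` holding for all large `n`. Then along some diagonal `n = φ m`
with `good m (φ m)` for all `m`, `X m (φ m) → Z` in distribution. (Lévy–Prokhorov metrisation of
convergence in distribution.) [cite: Billingsley1999, Thm. 6.8] -/
theorem exists_diagonal_tendstoInDistribution {E : Type*} [TopologicalSpace E]
    [PseudoMetrizableSpace E] [SeparableSpace E] [MeasurableSpace E] [OpensMeasurableSpace E]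
    {Ω : ℕ → Type*} {mΩ : ∀ n, MeasurableSpace (Ω n)} {P : ∀ n, Measure (Ω n)}
    [∀ n, IsProbabilityMeasure (P n)] {Ω' : Type*} {mΩ' : MeasurableSpace Ω'} {μ : Measure Ω'}
    [IsProbabilityMeasure μ] {X : ℕ → ∀ n, Ω n → E} {Y : ℕ → Ω' → E} {Z : Ω' → E}
    (hX : ∀ m, TendstoInDistribution (X m) atTop (Y m) P μ)
    (hY : TendstoInDistribution Y atTop Z (fun _ ↦ μ) μ)
    {good : ℕ → ℕ → Prop} (hgood : ∀ m, ∀ᶠ n in atTop, good m n) :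
    ∃ φ : ℕ → ℕ, (∀ m, good m (φ m)) ∧
      TendstoInDistribution (fun m ↦ X m (φ m)) atTop Z (fun m ↦ P (φ m)) μ := by
  obtain ⟨φ, hφ, hlim⟩ := exists_diagonal_tendsto (T := ProbabilityMeasure E)
    (x := fun m n ↦ ⟨(P n).map (X m n), Measure.isProbabilityMeasure_map
      ((hX m).forall_aemeasurable n)⟩)
    (y := fun m ↦ ⟨μ.map (Y m), Measure.isProbabilityMeasure_map (hX m).aemeasurable_limit⟩)
    (z := ⟨μ.map Z, Measure.isProbabilityMeasure_map hY.aemeasurable_limit⟩)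
    (fun m ↦ (hX m).tendsto) hY.tendsto hgood
  exact ⟨φ, hφ,
    { forall_aemeasurable := fun m ↦ (hX m).forall_aemeasurable (φ m)
      aemeasurable_limit := hY.aemeasurable_limit
      tendsto := hlim }⟩

/-! ### Paths frozen before a small time -/

/-- **A path frozen before `S₀` converges to the path as `S₀ → 0`**: for `W ∈ C([0, ∞), ℝ)`,
`(u ↦ W (u ∨ S₀)) → W` in the compact-open topology (indeed uniformly: the two differ only on
`[0, S₀]`, by at most the oscillation of `W` there). [folklore] -/
theorem _root_.ContinuousMap.tendsto_mk_comp_max_nhds_zero (W : C(ℝ≥0, ℝ))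
    (h : ∀ S₀ : ℝ≥0, Continuous fun u : ℝ≥0 ↦ W (max u S₀)) :
    Tendsto (fun S₀ : ℝ≥0 ↦ (⟨fun u ↦ W (max u S₀), h S₀⟩ : C(ℝ≥0, ℝ))) (𝓝 0) (𝓝 W) := by
  refine ContinuousMap.tendsto_of_tendstoLocallyUniformly
    (TendstoUniformly.tendstoLocallyUniformly ?_)
  rw [Metric.tendstoUniformly_iff]
  intro ε hε
  obtain ⟨η, hη, hWη⟩ := Metric.continuousAt_iff.1 (W.continuous.continuousAt (x := 0)) (ε / 2)
    (half_pos hε)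
  have hη' : (0 : ℝ≥0) < ⟨η, hη.le⟩ := hη
  filter_upwards [eventually_lt_nhds hη'] with S₀ hS₀ u
  change dist (W u) (W (max u S₀)) < ε
  rcases le_total S₀ u with hu | hu
  · rw [max_eq_left hu, dist_self]; exact hε
  · rw [max_eq_right hu]
    have hS₀' : dist S₀ 0 < η := by
      rw [NNReal.dist_eq, NNReal.coe_zero, sub_zero, abs_of_nonneg S₀.coe_nonneg]
      exact hS₀
    have hu' : dist u 0 < η := by
      rw [NNReal.dist_eq, NNReal.coe_zero, sub_zero, abs_of_nonneg u.coe_nonneg]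
      exact lt_of_le_of_lt (NNReal.coe_le_coe.2 hu) hS₀
    calc dist (W u) (W S₀) ≤ dist (W u) (W 0) + dist (W S₀) (W 0) := dist_triangle_right _ _ _
      _ < ε / 2 + ε / 2 := add_lt_add (hWη hu') (hWη hS₀')
      _ = ε := add_halves ε

/-! ### Cylinder identities at `s = 0` -/

variable {Ω : Type*} {mΩ : MeasurableSpace Ω} {μ : Measure Ω}

/-- **A cylinder identity extends to `s = 0`.** Let `X : ℝ≥0 → Ω → ℝ` have continuous paths, be
a.e. strongly measurable at each time and bounded by `C`; let `Ψ` be a.e. strongly measurable with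
`|Ψ| ≤ 1`; let `t > 0`. If `∫ (X_t - X_s) Ψ dμ = 0` for all `0 < s < t`, then
`∫ (X_t - X_0) Ψ dμ = 0` (let `s ↓ 0`, dominated convergence; finite measure).
[cite: CDHKSCRAS2014, §3] -/
theorem integral_sub_mul_eq_zero_zero_of_forall_pos [IsFiniteMeasure μ] {X : ℝ≥0 → Ω → ℝ}
    (hcont : ∀ ω, Continuous fun u ↦ X u ω) (hmeas : ∀ u, AEStronglyMeasurable (X u) μ) {C : ℝ}
    (hbd : ∀ u ω, |X u ω| ≤ C) {Ψ : Ω → ℝ} (hΨm : AEStronglyMeasurable Ψ μ) (hΨ1 : ∀ ω, |Ψ ω| ≤ 1)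
    {t : ℝ≥0} (ht : 0 < t)
    (h : ∀ s : ℝ≥0, 0 < s → s < t → ∫ ω, (X t ω - X s ω) * Ψ ω ∂μ = 0) :
    ∫ ω, (X t ω - X 0 ω) * Ψ ω ∂μ = 0 := by
  -- adapted from `integral_sub_mul_eq_zero_of_forall_lt_of_frozen` (FrozenCylinderExtension)
  obtain ⟨sm, -, hsm_mem, hsm_lim⟩ := exists_seq_strictAnti_tendsto' ht
  have hm : ∀ m, ∫ ω, (X t ω - X (sm m) ω) * Ψ ω ∂μ = 0 := fun m ↦
    h (sm m) (hsm_mem m).1 (hsm_mem m).2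
  have hmeas' : ∀ u, AEStronglyMeasurable (fun ω ↦ (X t ω - X u ω) * Ψ ω) μ := fun u ↦
    ((hmeas t).sub (hmeas u)).mul hΨm
  have hbd' : ∀ u ω, ‖(X t ω - X u ω) * Ψ ω‖ ≤ 2 * C := fun u ω ↦ by
    have hC : 0 ≤ C := (abs_nonneg _).trans (hbd u ω)
    rw [Real.norm_eq_abs, abs_mul]
    have h1 : |X t ω - X u ω| ≤ 2 * C := by
      have h2 := abs_sub (X t ω) (X u ω)
      linarith [hbd u ω, hbd t ω]
    calc |X t ω - X u ω| * |Ψ ω| ≤ 2 * C * 1 :=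
          mul_le_mul h1 (hΨ1 ω) (abs_nonneg _) (by linarith)
      _ = 2 * C := mul_one _
  have hlim : Tendsto (fun m ↦ ∫ ω, (X t ω - X (sm m) ω) * Ψ ω ∂μ) atTop
      (𝓝 (∫ ω, (X t ω - X 0 ω) * Ψ ω ∂μ)) := by
    refine tendsto_integral_of_dominated_convergence (fun _ ↦ 2 * C) (fun m ↦ hmeas' _)
      (integrable_const _) (fun m ↦ ae_of_all _ fun ω ↦ hbd' _ ω) (ae_of_all _ fun ω ↦ ?_)
    exact (tendsto_const_nhds.sub (((hcont ω).tendsto 0).comp hsm_lim)).mul tendsto_const_nhds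
  have h0 : Tendsto (fun m ↦ ∫ ω, (X t ω - X (sm m) ω) * Ψ ω ∂μ) atTop (𝓝 0) := by
    simp_rw [hm]
    exact tendsto_const_nhds
  exact tendsto_nhds_unique hlim h0

end Literature.Probability.Process

end
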